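import Literature.AnabelianGeometry.SemiGraphs.PSCSeparatingCoveringsProofs
import Literature.AnabelianGeometry.SemiGraphs.Coverticial
import Literature.AnabelianGeometry.SemiGraphs.GraphOfAnabelioidsGalois
import Literature.AnabelianGeometry.Anabelioids.AutOfEquivalence

/-!
# [SemiAnbd] Remark 2.10.1 reduced to level-wise edge separation inside `Π_𝒢`

Mochizuki, *Semi-graphs of anabelioids*, Publ. RIMS **42** (2006), Remark 2.10.1 p. 32: "In the case of
Example 2.10, it is not difficult to show, using exactly the same techniques as those used in the
proofs of Proposition 2.6, Corollary 2.7, that `C_{Π_𝒢}(Π_b) = Π_b`.  Since, however, we shall not need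
this result in the following, and, moreover, a precise description of the condition on edges in the
case of a more general `𝒢` necessary to carry out such an argument [i.e., the analogue for edges of
the notion of an 'elevated vertex'] would be rather technical to write out in detail, we leave the
task of working out the routine details to the interested reader."
[cite: MochizukiSemiAnbd2006, Rem. 2.10.1 p.32]

Statements-first sub-DAG of that reader's task (cell abc-iut, layer L3, row F-1477 `remark_2_10_1`,
seat abc-iut-L3-t12).  The proof of Corollary 2.7 (i), p. 30, run for an EDGE group `A = Π_b ⊆ Π_𝒢`:
`g ∈ C_{Π_𝒢}(A)` gives an open normal `V ⊆ Π_𝒢` with `V ∩ A ⊆ gAg⁻¹`; if `g ∉ V·A`, the two edges of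
the finite étale Galois covering `𝒢_V → 𝒢` through the base point and through its `g`-translate are
DISTINCT, and a finite étale covering of `𝒢_V` (again of surface type) trivial over the second and
ramified over the first (`SurfaceTypeEdgeSeparation.lean`, applied to `𝒢_V`) contradicts
`V ∩ A ⊆ gAg⁻¹`; hence `g ∈ ⋂_V V·A = A`.  This file TYPES the one intermediate statement — the
level-wise edge separation INSIDE `Π_𝒢`, `LevelEdgeSeparation`: "`V ∩ Π_b ⊆ g Π_b g⁻¹` forces
`g ∈ V·Π_b`" (NOT proved here: it is `SurfaceTypeEdgeSeparation` at every Galois level `𝒢_V`,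
through the §2 covering dictionary and `IsOfSurfaceType.of_isFiniteEtaleCoveringGlobal`) — and
PROVES the reduction `remark_2_10_1_of_levelEdgeSeparation` by the profinite closing argument of
[CombGC] Prop. 1.2 (ii) (abc-iut-w5-d183's `PSCDatum.commensurator_eq_of_levelwise`).
No statement here takes a side on any disputed claim; nothing about [IUTchIII] Cor. 3.12.
-/

namespace Literature.AnabelianGeometry.SemiGraphs

open CategoryTheory CategoryTheory.PreGaloisCategory
open Literature.AnabelianGeometry.Anabelioids
open scoped Pointwise

universe v₁ u₁ u

namespace SemiGraphOfAnabelioids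

/-- SUB-NODE of [SemiAnbd] Remark 2.10.1 (the level-wise EDGE SEPARATION inside `Π_𝒢`, i.e. the
content of "the same techniques as … Proposition 2.6, Corollary 2.7" for an edge group): for `𝒢` of
surface type and connected, a branch `b ∈ e` at `v`, the basepoint of `B(𝒢)` through `v` induced
from a basepoint `F_e` of `𝒢_e` along `b`, `A := Im(Π_b → Π_𝒢)`, every open normal subgroup
`V ⊆ Π_𝒢` and every `g ∈ Π_𝒢`: if `V ∩ A ⊆ g A g⁻¹` then `g ∈ V · A`.  (Equivalently: the edges of the
Galois covering `𝒢_V` through the base point and through its `g`-translate, when distinct, are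
separated by a finite étale covering of `𝒢_V` — `SurfaceTypeEdgeSeparation` one level up.)  NOT
proved in this file. [cite: MochizukiSemiAnbd2006, Rem. 2.10.1 p.32] -/
def LevelEdgeSeparation : Prop :=
  ∀ (𝒢 : SemiGraphOfAnabelioids.{v₁, u₁, u}) (Sigma : Set ℕ), 𝒢.IsOfSurfaceType Sigma →
    𝒢.IsConnected → ∀ (b : 𝒢.graph.Branch) (v : 𝒢.graph.Vertex) (h : 𝒢.graph.abuts b = some v)
      (Fe : 𝒢.E (𝒢.graph.edgeOf b) ⥤ FintypeCat.{v₁}) [FiberFunctor Fe]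
      (V : Subgroup (𝒢.Pi v ((𝒢.pull b v h).pullback ⋙ Fe))),
      IsOpen (V : Set (𝒢.Pi v ((𝒢.pull b v h).pullback ⋙ Fe))) → V.Normal →
      ∀ g : 𝒢.Pi v ((𝒢.pull b v h).pullback ⋙ Fe),
        V ⊓ (𝒢.piBToPi b v h Fe).range ≤ ConjAct.toConjAct g • (𝒢.piBToPi b v h Fe).range →
        g ∈ (V : Set (𝒢.Pi v ((𝒢.pull b v h).pullback ⋙ Fe))) *
          ((𝒢.piBToPi b v h Fe).range : Set (𝒢.Pi v ((𝒢.pull b v h).pullback ⋙ Fe)))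

/-- **Remark 2.10.1 follows from level-wise edge separation** — the profinite closing argument of the
proof of Cor. 2.7 (i) / [CombGC] Prop. 1.2 (ii): `Π_b ⊆ Π_𝒢` is closed (continuous image of the
compact `Π_e`); for `g ∈ C_{Π_𝒢}(Π_b)` the intersection `Π_b ∩ g Π_b g⁻¹` is relatively open in
`Π_b`, so at every open normal level `U` some smaller open normal `V ⊆ U` has `V ∩ Π_b ⊆ g Π_b g⁻¹`,
whence `g ∈ V·Π_b ⊆ U·Π_b` by `LevelEdgeSeparation`, and `⋂_U U·Π_b = Π_b`.
[cite: MochizukiSemiAnbd2006, Rem. 2.10.1 p.32] -/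
theorem remark_2_10_1_of_levelEdgeSeparation (hsep : LevelEdgeSeparation.{v₁, u₁, u}) :
    remark_2_10_1.{v₁, u₁, u} := by
  intro 𝒢 Sigma hS hconn b v h Fe _
  -- `B(𝒢)` is a Galois category and the basepoint through `v` is a fibre functor
  letI := 𝒢.galoisCategory_bObj hconn
  haveI : FiberFunctor ((𝒢.pull b v h).pullback ⋙ Fe) := fiberFunctor_comp_of_exact _ Fe
  haveI : FiberFunctor (𝒢.ρ v ⋙ ((𝒢.pull b v h).pullback ⋙ Fe)) := 𝒢.fiberFunctor_ρ hconn v _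
  set A : Subgroup (𝒢.Pi v ((𝒢.pull b v h).pullback ⋙ Fe)) := (𝒢.piBToPi b v h Fe).range with hAdef
  -- `A` is closed: the continuous image of the compact group `Π_e`
  have hcont : Continuous (𝒢.piBToPi b v h Fe) :=
    (continuous_pi1Map' (𝒢.ρ v) _).comp (continuous_pi1Map' (𝒢.pull b v h).pullback Fe)
  have hAc : IsClosed (A : Set (𝒢.Pi v ((𝒢.pull b v h).pullback ⋙ Fe))) := by
    rw [hAdef, MonoidHom.coe_range]
    exact (isCompact_range hcont).isClosed
  refine ⟨PSCDatum.commensurator_eq_of_levelwise (K := ⊥) hAc bot_le fun U hUo hUn _ g hopen => ?_⟩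
  -- shrink: an open normal `U' ` with `U' ∩ (U ∩ A) ⊆ gAg⁻¹`
  haveI := hUn
  obtain ⟨U', hU'o, hU'n, -, hU'le⟩ :=
    PSCDatum.exists_openNormal_inf_le (K := ⊥) (A₁ := U ⊓ A) (A₂ := ConjAct.toConjAct g • A)
      bot_le bot_le hopen
  haveI := hU'n
  -- the level `V := U' ∩ U`
  have hV : (U' ⊓ U) ⊓ A ≤ ConjAct.toConjAct g • A := by
    intro x hx
    exact hU'le ⟨hx.1.1, hx.1.2, hx.2⟩
  have hg := hsep 𝒢 Sigma hS hconn b v h Fe (U' ⊓ U) (hU'o.inter hUo) inferInstance g hV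
  obtain ⟨x, hx, a, ha, rfl⟩ := Set.mem_mul.mp hg
  exact Set.mem_mul.mpr ⟨x, (Subgroup.mem_inf.mp hx).2, a, ha, rfl⟩

end SemiGraphOfAnabelioids

end Literature.AnabelianGeometry.SemiGraphs
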